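import Mathlib.Analysis.SpecialFunctions.Pow.NNReal
import Literature.NumberTheory.DiophantineGeometry.ShuteFourSquareful

/-!
# Shute (2021), §3: the Hölder step of Proposition 3.2, in exact arithmetic

Companion to `ShuteFourSquareful.lean` (the named fact
`Literature.NumberTheory.DiophantineGeometry.Shute2021_prop32`, Shute's Prop. 3.2:
`N(𝐗, 𝐘) ≪_ε (X₁X₂X₃X₄)^{1/2+ε} (Y₁Y₂Y₃Y₄)^{2/3+ε}`).

The printed proof of Prop. 3.2 (A. Shute, *Sums of four squareful numbers*, arXiv:2104.06966, §3)
has two parts: (i) Hölder, `N(𝐗, 𝐘) = ∫₀¹ S₁S₂S₃S₄ ≤ ∏ₖ (∫₀¹ |S_k|⁴)^{1/4}` with `∫₀¹|S_k|⁴ = N(X_k, Y_k)`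
the fourth moment (`Shute2021.fourthMoment`); (ii) the fourth-moment estimate
`N(X, Y) = O(X^{2+ε} Y^{8/3+ε})`. This file proves (i) WITHOUT Fourier analysis, as the integer
inequality `N(𝐗, 𝐘)⁴ ≤ ∏ᵢ N(Xᵢ, Yᵢ)` (`Shute2021.quadricCount_pow_four_le`, two applications of the
Cauchy–Schwarz inequality for collision counts, `Shute2021.coll_sq_le`), and records the resulting
reduction: `Shute2021_prop32` is EQUIVALENT to the fourth-moment bound with exponent `8/3`
(`Shute2021_prop32_iff_fourthMoment_le`; the direction Prop. 3.2 ⟹ moment bound is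
`Shute2021_prop32.fourthMoment_le` of the companion file), and more generally a moment bound
`N(X, Y) ≤ C_ε X^{2+ε} Y^{θ+ε}` gives `N(𝐗, 𝐘) ≤ C_ε ∏Xᵢ^{1/2+ε} ∏Yᵢ^{θ/4+ε}`
(`Shute2021.quadricCount_le_of_fourthMoment_le`).

Status of (ii): the printed argument for the exponent `8/3` passes through
`N(X, Y) ≤ XY · L'(X, Y)` (two further Cauchy–Schwarz steps), but `L'(X, Y)` contains the
`≍ X²Y²` tuples with `y₁ = y₂`, `x₁ = ±x₂`, so that `XY · L' ≫ X³Y³`; the displayed bound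
`L ≪ X^{1+ε}Y^{5/3+ε}` (loc. cit., end of §3) is therefore not correct as printed and part (ii) is
not reproduced here. What the elementary method does give (one Cauchy–Schwarz in `y₁` and the
divisor bound: exponent `3` in place of `8/3`, hence `3/4` in place of `2/3` in Prop. 3.2) is
proved in `ShuteFourSquarefulMoment.lean`.

## Contents

* `Shute2021.coll A B f g = #{(a, b) ∈ A × B : f a = g b}` and the Cauchy–Schwarz inequality
  `coll(A, B)² ≤ coll(A, A) · coll(B, B)` (`Shute2021.coll_sq_le`);
* `Shute2021.zeroSumCount`, `Shute2021.mixedEnergy`, `Shute2021.diffEnergy` and Hölder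
  `T(A, B, C, D)⁴ ≤ E(A) E(B) E(C) E(D)` (`Shute2021.zeroSumCount_pow_four_le`);
* the parameter sets `Shute2021.pts X Y = {(x, y) : 0 < |x| ≤ X, 0 < |y| ≤ Y, y square-free}`,
  `Shute2021.val (x, y) = x² y³`, and the identifications
  `quadricCount X Y = zeroSumCount val (pts …)` and `fourthMoment X Y = diffEnergy val (pts X Y)`;
* `Shute2021.quadricCount_pow_four_le`, `Shute2021.quadricCount_le_of_fourthMoment_le`,
  `Shute2021_prop32_of_fourthMoment_le`, `Shute2021_prop32_iff_fourthMoment_le`.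

## References

* A. Shute, *Sums of four squareful numbers*, arXiv:2104.06966 (2021), §3, Prop. 3.2 and its
  proof (Hölder step; definition of the fourth moment `N(X, Y)`). [Shute2021]
-/

noncomputable section

open Finset

namespace Literature.NumberTheory.DiophantineGeometry

namespace Shute2021

/-! ### Collision counts -/

section Collision

variable {α β M : Type*} [DecidableEq M]

/-- The number of **collisions** between `f` on `A` and `g` on `B`: pairs `(a, b) ∈ A × B` with
`f a = g b`. [folklore] -/
def coll (A : Finset α) (B : Finset β) (f : α → M) (g : β → M) : ℕ :=
  #{p ∈ A ×ˢ B | f p.1 = g p.2}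

/-- Fibrewise expansion of the collision count over any set `S` containing the values of `f`:
`coll A B f g = Σ_{m ∈ S} #{a : f a = m} · #{b : g b = m}`. [folklore] -/
theorem coll_eq_sum (A : Finset α) (B : Finset β) (f : α → M) (g : β → M) {S : Finset M}
    (hS : ∀ a ∈ A, f a ∈ S) :
    coll A B f g = ∑ m ∈ S, #{a ∈ A | f a = m} * #{b ∈ B | g b = m} := by
  unfold coll
  rw [card_eq_sum_card_fiberwise (f := fun p : α × β => f p.1) (t := S)]
  · refine sum_congr rfl fun m _ => ?_
    rw [← card_product, ← filter_product]
    congr 1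
    ext p
    simp only [mem_filter, mem_product]
    constructor
    · rintro ⟨⟨hp, h1⟩, h2⟩
      exact ⟨hp, h2, h1 ▸ h2⟩
    · rintro ⟨hp, h1, h2⟩
      exact ⟨⟨hp, h1.trans h2.symm⟩, h1⟩
  · intro p hp
    have hp' := Finset.mem_coe.1 hp
    rw [mem_filter, mem_product] at hp'
    exact Finset.mem_coe.2 (hS _ hp'.1.1)

/-- **Cauchy–Schwarz for collisions**: `coll(A, B)² ≤ coll(A, A) · coll(B, B)`. [folklore] -/
theorem coll_sq_le (A : Finset α) (B : Finset β) (f : α → M) (g : β → M) :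
    coll A B f g ^ 2 ≤ coll A A f f * coll B B g g := by
  classical
  set S : Finset M := A.image f ∪ B.image g with hS_def
  have hA : ∀ a ∈ A, f a ∈ S := fun a ha => mem_union_left _ (mem_image_of_mem f ha)
  have hB : ∀ b ∈ B, g b ∈ S := fun b hb => mem_union_right _ (mem_image_of_mem g hb)
  rw [coll_eq_sum A B f g hA, coll_eq_sum A A f f hA, coll_eq_sum B B g g hB]
  simp_rw [← sq]
  exact sum_mul_sq_le_sq_mul_sq (R := ℕ) S _ _

/-- Collisions are symmetric under negating both maps (in an additive group). [folklore] -/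
theorem coll_neg {G : Type*} [DecidableEq G] [AddGroup G] (A : Finset α) (B : Finset β)
    (f : α → G) (g : β → G) :
    coll A B (fun a => -f a) (fun b => -g b) = coll A B f g := by
  unfold coll
  simp_rw [neg_inj]

end Collision

/-! ### Hölder for the number of solutions of `φ a + φ b + φ c + φ d = 0` -/

section Holder

variable {α : Type*}

/-- `T(A, B, C, D) = #{(a, b, c, d) ∈ A × B × C × D : φ a + φ b + φ c + φ d = 0}`. [folklore] -/
def zeroSumCount (φ : α → ℤ) (A B C D : Finset α) : ℕ :=
  #{q ∈ (A ×ˢ B) ×ˢ (C ×ˢ D) | φ q.1.1 + φ q.1.2 + φ q.2.1 + φ q.2.2 = 0}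

/-- The mixed energy `E(A, B) = #{(a, b, a', b') : φ a + φ b = φ a' + φ b'}`. [folklore] -/
def mixedEnergy (φ : α → ℤ) (A B : Finset α) : ℕ :=
  coll (A ×ˢ B) (A ×ˢ B) (fun p => φ p.1 + φ p.2) (fun p => φ p.1 + φ p.2)

/-- The energy `E(A) = #{((a, a'), (b, b')) ∈ (A × A) × (A × A) : φ a - φ a' = φ b - φ b'}`.
[folklore] -/
def diffEnergy (φ : α → ℤ) (A : Finset α) : ℕ :=
  coll (A ×ˢ A) (A ×ˢ A) (fun p => φ p.1 - φ p.2) (fun p => φ p.1 - φ p.2)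

/-- `T` is a collision count between `A × B` and `C × D`. [folklore] -/
theorem zeroSumCount_eq_coll (φ : α → ℤ) (A B C D : Finset α) :
    zeroSumCount φ A B C D =
      coll (A ×ˢ B) (C ×ˢ D) (fun p => φ p.1 + φ p.2) (fun p => -(φ p.1 + φ p.2)) := by
  unfold zeroSumCount coll
  congr 1
  refine filter_congr fun q _ => ?_
  constructor <;> intro h <;> linear_combination h

/-- First Cauchy–Schwarz: `T² ≤ E(A, B) · E(C, D)`. [folklore] -/
theorem zeroSumCount_sq_le (φ : α → ℤ) (A B C D : Finset α) :
    zeroSumCount φ A B C D ^ 2 ≤ mixedEnergy φ A B * mixedEnergy φ C D := by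
  rw [zeroSumCount_eq_coll]
  refine (coll_sq_le _ _ _ _).trans (le_of_eq ?_)
  unfold mixedEnergy
  rw [coll_neg]

/-- The mixed energy as a collision count between `A × A` and `B × B` (differences).
[folklore] -/
theorem mixedEnergy_eq_coll (φ : α → ℤ) (A B : Finset α) :
    mixedEnergy φ A B =
      coll (A ×ˢ A) (B ×ˢ B) (fun p => φ p.1 - φ p.2) (fun p => -(φ p.1 - φ p.2)) := by
  unfold mixedEnergy coll
  refine card_equiv (Equiv.prodProdProdComm _ _ _ _) fun q => ?_
  simp only [mem_filter, mem_product, Equiv.prodProdProdComm_apply]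
  constructor
  · rintro ⟨⟨⟨ha, hb⟩, ha', hb'⟩, h⟩
    exact ⟨⟨⟨ha, ha'⟩, hb, hb'⟩, by linear_combination h⟩
  · rintro ⟨⟨⟨ha, ha'⟩, hb, hb'⟩, h⟩
    exact ⟨⟨⟨ha, hb⟩, ha', hb'⟩, by linear_combination h⟩

/-- Second Cauchy–Schwarz: `E(A, B)² ≤ E(A) · E(B)`. [folklore] -/
theorem mixedEnergy_sq_le (φ : α → ℤ) (A B : Finset α) :
    mixedEnergy φ A B ^ 2 ≤ diffEnergy φ A * diffEnergy φ B := by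
  rw [mixedEnergy_eq_coll]
  refine (coll_sq_le _ _ _ _).trans (le_of_eq ?_)
  unfold diffEnergy
  rw [coll_neg]

/-- **Hölder**: `T(A, B, C, D)⁴ ≤ E(A) E(B) E(C) E(D)`. [folklore] -/
theorem zeroSumCount_pow_four_le (φ : α → ℤ) (A B C D : Finset α) :
    zeroSumCount φ A B C D ^ 4 ≤
      diffEnergy φ A * diffEnergy φ B * (diffEnergy φ C * diffEnergy φ D) := by
  calc zeroSumCount φ A B C D ^ 4 = (zeroSumCount φ A B C D ^ 2) ^ 2 := by ring
    _ ≤ (mixedEnergy φ A B * mixedEnergy φ C D) ^ 2 :=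
        Nat.pow_le_pow_left (zeroSumCount_sq_le φ A B C D) 2
    _ = mixedEnergy φ A B ^ 2 * mixedEnergy φ C D ^ 2 := by ring
    _ ≤ _ := Nat.mul_le_mul (mixedEnergy_sq_le φ A B) (mixedEnergy_sq_le φ C D)

end Holder

/-! ### The counts of §3 as collision counts -/

section Points

/-- The parameter points `(x, y)` with `0 < |x| ≤ X`, `0 < |y| ≤ Y`, `y` square-free. [folklore] -/
def pts (X Y : ℕ) : Finset (ℤ × ℤ) :=
  ((Icc (-(X : ℤ)) X).filter fun x => x ≠ 0) ×ˢ
    ((Icc (-(Y : ℤ)) Y).filter fun y => y ≠ 0 ∧ Squarefree y.natAbs)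

/-- The squareful value `x² y³` of a parameter point. [folklore] -/
def val (p : ℤ × ℤ) : ℤ := p.1 ^ 2 * p.2 ^ 3

/-- Membership in `pts X Y`. [folklore] -/
theorem mem_pts {X Y : ℕ} {p : ℤ × ℤ} :
    p ∈ pts X Y ↔ (|p.1| ≤ X ∧ p.1 ≠ 0) ∧ (|p.2| ≤ Y ∧ p.2 ≠ 0 ∧ Squarefree p.2.natAbs) := by
  simp only [pts, mem_product, mem_filter, mem_Icc, abs_le]

/-- Unpacking `(𝐱, 𝐲) ∈ ℤ⁴ × ℤ⁴` into four points, in the order `(0, 1), (2, 3)`. [folklore] -/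
def toQuad (p : (Fin 4 → ℤ) × (Fin 4 → ℤ)) : ((ℤ × ℤ) × (ℤ × ℤ)) × ((ℤ × ℤ) × (ℤ × ℤ)) :=
  (((p.1 0, p.2 0), (p.1 1, p.2 1)), ((p.1 2, p.2 2), (p.1 3, p.2 3)))

/-- Packing four points into `(𝐱, 𝐲)`, inverse to `toQuad`. [folklore] -/
def ofQuad (q : ((ℤ × ℤ) × (ℤ × ℤ)) × ((ℤ × ℤ) × (ℤ × ℤ))) : (Fin 4 → ℤ) × (Fin 4 → ℤ) :=
  (![q.1.1.1, q.1.2.1, q.2.1.1, q.2.2.1], ![q.1.1.2, q.1.2.2, q.2.1.2, q.2.2.2])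

/-- `ofQuad ∘ toQuad = id`. [folklore] -/
@[simp] theorem ofQuad_toQuad (p : (Fin 4 → ℤ) × (Fin 4 → ℤ)) : ofQuad (toQuad p) = p :=
  Prod.ext (funext fun i => by fin_cases i <;> rfl) (funext fun i => by fin_cases i <;> rfl)

/-- `toQuad ∘ ofQuad = id`. [folklore] -/
@[simp] theorem toQuad_ofQuad (q : ((ℤ × ℤ) × (ℤ × ℤ)) × ((ℤ × ℤ) × (ℤ × ℤ))) :
    toQuad (ofQuad q) = q := rfl

/-- The side conditions of `quadricCount`/`fourthMoment` at `(𝐱, 𝐲)` are membership of the four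
points in the parameter sets. [folklore] -/
theorem side_iff {X Y : Fin 4 → ℕ} (p : (Fin 4 → ℤ) × (Fin 4 → ℤ)) :
    (p ∈ box X ×ˢ box Y ∧ ∀ i, p.1 i ≠ 0 ∧ p.2 i ≠ 0 ∧ Squarefree (p.2 i).natAbs) ↔
      ((p.1 0, p.2 0) ∈ pts (X 0) (Y 0) ∧ (p.1 1, p.2 1) ∈ pts (X 1) (Y 1)) ∧
        ((p.1 2, p.2 2) ∈ pts (X 2) (Y 2) ∧ (p.1 3, p.2 3) ∈ pts (X 3) (Y 3)) := by
  simp only [mem_product, mem_box, mem_pts]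
  constructor
  · rintro ⟨⟨hx, hy⟩, h⟩
    exact ⟨⟨⟨⟨hx 0, (h 0).1⟩, hy 0, (h 0).2⟩, ⟨⟨hx 1, (h 1).1⟩, hy 1, (h 1).2⟩⟩,
      ⟨⟨⟨hx 2, (h 2).1⟩, hy 2, (h 2).2⟩, ⟨⟨hx 3, (h 3).1⟩, hy 3, (h 3).2⟩⟩⟩
  · rintro ⟨⟨h0, h1⟩, h2, h3⟩
    refine ⟨⟨fun i => ?_, fun i => ?_⟩, fun i => ?_⟩
    · fin_cases i
      exacts [h0.1.1, h1.1.1, h2.1.1, h3.1.1]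
    · fin_cases i
      exacts [h0.2.1, h1.2.1, h2.2.1, h3.2.1]
    · fin_cases i
      exacts [⟨h0.1.2, h0.2.2⟩, ⟨h1.1.2, h1.2.2⟩, ⟨h2.1.2, h2.2.2⟩, ⟨h3.1.2, h3.2.2⟩]

/-- **`N(𝐗, 𝐘)` is a zero-sum count** over the four parameter sets. [folklore] -/
theorem quadricCount_eq_zeroSumCount (X Y : Fin 4 → ℕ) :
    quadricCount X Y =
      zeroSumCount val (pts (X 0) (Y 0)) (pts (X 1) (Y 1)) (pts (X 2) (Y 2)) (pts (X 3) (Y 3)) := by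
  unfold quadricCount zeroSumCount
  refine card_nbij' toQuad ofQuad ?_ ?_ (fun p _ => ofQuad_toQuad p) (fun q _ => toQuad_ofQuad q)
  · intro p hp
    rw [mem_coe, mem_filter] at hp ⊢
    obtain ⟨hmem, hside, hsum⟩ := hp
    refine ⟨?_, ?_⟩
    · rw [mem_product, mem_product, mem_product]
      exact (side_iff p).1 ⟨hmem, hside⟩
    · rw [Fin.sum_univ_four] at hsum
      exact hsum
  · intro q hq
    rw [mem_coe, mem_filter] at hq ⊢
    obtain ⟨hmem, hsum⟩ := hq
    rw [mem_product, mem_product, mem_product] at hmem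
    have hside := (side_iff (X := X) (Y := Y) (ofQuad q)).2 hmem
    refine ⟨hside.1, hside.2, ?_⟩
    rw [Fin.sum_univ_four]
    exact hsum

/-- **The fourth moment is a difference energy** of the parameter set:
`x₀²y₀³ + x₁²y₁³ = x₂²y₂³ + x₃²y₃³ ⟺ val p₀ - val p₂ = val p₃ - val p₁`. [folklore] -/
theorem fourthMoment_eq_diffEnergy (X Y : ℕ) :
    fourthMoment X Y = diffEnergy val (pts X Y) := by
  unfold fourthMoment diffEnergy coll
  -- reorder the four points as `(0, 2), (3, 1)`
  refine card_nbij' (fun p => (((p.1 0, p.2 0), (p.1 2, p.2 2)), ((p.1 3, p.2 3), (p.1 1, p.2 1))))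
    (fun q => (![q.1.1.1, q.2.2.1, q.1.2.1, q.2.1.1], ![q.1.1.2, q.2.2.2, q.1.2.2, q.2.1.2]))
    ?_ ?_ ?_ ?_
  · intro p hp
    rw [mem_coe, mem_filter] at hp ⊢
    obtain ⟨hmem, hside, hsum⟩ := hp
    have h := (side_iff (X := fun _ => X) (Y := fun _ => Y) p).1 ⟨hmem, hside⟩
    refine ⟨?_, ?_⟩
    · rw [mem_product, mem_product, mem_product]
      exact ⟨⟨h.1.1, h.2.1⟩, h.2.2, h.1.2⟩
    · change p.1 0 ^ 2 * p.2 0 ^ 3 - p.1 2 ^ 2 * p.2 2 ^ 3 = p.1 3 ^ 2 * p.2 3 ^ 3 - p.1 1 ^ 2 * p.2 1 ^ 3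
      linear_combination hsum
  · intro q hq
    rw [mem_coe, mem_filter] at hq ⊢
    obtain ⟨hmem, hsum⟩ := hq
    rw [mem_product, mem_product, mem_product] at hmem
    have hside := (side_iff (X := fun _ => X) (Y := fun _ => Y)
      (![q.1.1.1, q.2.2.1, q.1.2.1, q.2.1.1], ![q.1.1.2, q.2.2.2, q.1.2.2, q.2.1.2])).2
      ⟨⟨hmem.1.1, hmem.2.2⟩, hmem.1.2, hmem.2.1⟩
    refine ⟨hside.1, hside.2, ?_⟩
    change q.1.1.1 ^ 2 * q.1.1.2 ^ 3 - q.1.2.1 ^ 2 * q.1.2.2 ^ 3 =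
      q.2.1.1 ^ 2 * q.2.1.2 ^ 3 - q.2.2.1 ^ 2 * q.2.2.2 ^ 3 at hsum
    change q.1.1.1 ^ 2 * q.1.1.2 ^ 3 + q.2.2.1 ^ 2 * q.2.2.2 ^ 3 =
      q.1.2.1 ^ 2 * q.1.2.2 ^ 3 + q.2.1.1 ^ 2 * q.2.1.2 ^ 3
    linear_combination hsum
  · intro p _
    exact Prod.ext (funext fun i => by fin_cases i <;> rfl) (funext fun i => by fin_cases i <;> rfl)
  · intro q _
    rfl

/-- **Hölder's inequality for `N(𝐗, 𝐘)`** (the step `N(𝐗,𝐘) ≤ ∏ₖ (∫|S_k|⁴)^{1/4}` of the proof of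
Prop. 3.2, in exact arithmetic): `N(𝐗, 𝐘)⁴ ≤ ∏ᵢ N(Xᵢ, Yᵢ)`.
[cite: Shute2021, §3, proof of Prop. 3.2 (Hölder step)] -/
theorem quadricCount_pow_four_le (X Y : Fin 4 → ℕ) :
    quadricCount X Y ^ 4 ≤ ∏ i, fourthMoment (X i) (Y i) := by
  rw [Fin.prod_univ_four, quadricCount_eq_zeroSumCount]
  simp only [fourthMoment_eq_diffEnergy]
  calc _ ≤ _ := zeroSumCount_pow_four_le val _ _ _ _
    _ = _ := by ring

end Points

/-! ### From a fourth-moment bound to the bound for `N(𝐗, 𝐘)` -/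

section Assembly

/-- Fourth roots: `q⁴ ≤ R` with `q ≥ 0` gives `q ≤ R^{1/4}`. [folklore] -/
theorem le_rpow_inv_four_of_pow_four_le {q R : ℝ} (hq : 0 ≤ q) (h : q ^ 4 ≤ R) :
    q ≤ R ^ (1 / 4 : ℝ) := by
  have hq4 : (q ^ 4) ^ (1 / 4 : ℝ) = q := by
    rw [show (1 / 4 : ℝ) = ((4 : ℕ) : ℝ)⁻¹ by norm_num]
    exact Real.pow_rpow_inv_natCast hq (by norm_num)
  calc q = (q ^ 4) ^ (1 / 4 : ℝ) := hq4.symm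
    _ ≤ R ^ (1 / 4 : ℝ) := Real.rpow_le_rpow (by positivity) h (by norm_num)

/-- Exponent bookkeeping: `(C⁴ · P^a · Q^b)^{1/4} = C · P^{a/4} · Q^{b/4}` for `C, P, Q ≥ 0`.
[folklore] -/
theorem rpow_inv_four_prod {C P Q : ℝ} (hC : 0 ≤ C) (hP : 0 ≤ P) (hQ : 0 ≤ Q) (a b : ℝ) :
    (C ^ 4 * P ^ a * Q ^ b) ^ (1 / 4 : ℝ) = C * P ^ (a / 4) * Q ^ (b / 4) := by
  have hC4 : (C ^ 4) ^ (1 / 4 : ℝ) = C := by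
    rw [show (1 / 4 : ℝ) = ((4 : ℕ) : ℝ)⁻¹ by norm_num]
    exact Real.pow_rpow_inv_natCast hC (by norm_num)
  rw [Real.mul_rpow (by positivity) (by positivity), Real.mul_rpow (by positivity) (by positivity),
    hC4, ← Real.rpow_mul hP, ← Real.rpow_mul hQ]
  congr 2 <;> ring

/-- **Hölder reduction** (Shute's deduction of Prop. 3.2 from the fourth-moment bound, with a
general exponent `θ` on `Y`): if `N(X, Y) ≤ C_ε X^{2+ε} Y^{θ+ε}` for all `X, Y ≥ 1`, then
`N(𝐗, 𝐘) ≤ C'_ε (X₁X₂X₃X₄)^{1/2+ε} (Y₁Y₂Y₃Y₄)^{θ/4+ε}`.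
[cite: Shute2021, §3, proof of Prop. 3.2 (Hölder step)] -/
theorem quadricCount_le_of_fourthMoment_le {θ : ℝ}
    (h : ∀ ε : ℝ, 0 < ε → ∃ C : ℝ, 0 < C ∧ ∀ X Y : ℕ, 1 ≤ X → 1 ≤ Y →
      (fourthMoment X Y : ℝ) ≤ C * (X : ℝ) ^ (2 + ε) * (Y : ℝ) ^ (θ + ε)) :
    ∀ ε : ℝ, 0 < ε → ∃ C : ℝ, 0 < C ∧ ∀ X Y : Fin 4 → ℕ, (∀ i, 1 ≤ X i) → (∀ i, 1 ≤ Y i) →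
      (quadricCount X Y : ℝ) ≤
        C * (∏ i, (X i : ℝ)) ^ (1 / 2 + ε) * (∏ i, (Y i : ℝ)) ^ (θ / 4 + ε) := by
  intro ε hε
  obtain ⟨C, hC, hN⟩ := h (4 * ε) (by positivity)
  refine ⟨C, hC, fun X Y hX hY => ?_⟩
  have h4 : (quadricCount X Y : ℝ) ^ 4 ≤ ∏ i, (fourthMoment (X i) (Y i) : ℝ) := by
    exact_mod_cast quadricCount_pow_four_le X Y
  have hprod : ∏ i, (fourthMoment (X i) (Y i) : ℝ) ≤
      ∏ i, (C * (X i : ℝ) ^ (2 + 4 * ε) * (Y i : ℝ) ^ (θ + 4 * ε)) :=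
    prod_le_prod (fun i _ => by positivity) fun i _ => hN _ _ (hX i) (hY i)
  have hsplit : ∏ i, (C * (X i : ℝ) ^ (2 + 4 * ε) * (Y i : ℝ) ^ (θ + 4 * ε)) =
      C ^ 4 * (∏ i, (X i : ℝ)) ^ (2 + 4 * ε) * (∏ i, (Y i : ℝ)) ^ (θ + 4 * ε) := by
    rw [prod_mul_distrib, prod_mul_distrib, prod_const, card_univ, Fintype.card_fin,
      Real.finsetProd_rpow _ _ (fun i _ => by positivity),
      Real.finsetProd_rpow _ _ (fun i _ => by positivity)]
  have key := le_rpow_inv_four_of_pow_four_le (by positivity) ((h4.trans hprod).trans_eq hsplit)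
  rw [rpow_inv_four_prod hC.le (by positivity) (by positivity)] at key
  convert key using 3 <;> ring

/-- **Prop. 3.2 follows from the fourth-moment bound with exponent `8/3`** (the paper's
"(the old prop)" `N(X, Y) = O(X^{2+ε} Y^{8/3+ε})`), by Hölder. This isolates exactly what a proof
of `Shute2021_prop32` has to supply. [cite: Shute2021, §3, proof of Prop. 3.2] -/
theorem Shute2021_prop32_of_fourthMoment_le
    (h : ∀ ε : ℝ, 0 < ε → ∃ C : ℝ, 0 < C ∧ ∀ X Y : ℕ, 1 ≤ X → 1 ≤ Y →
      (fourthMoment X Y : ℝ) ≤ C * (X : ℝ) ^ (2 + ε) * (Y : ℝ) ^ (8 / 3 + ε)) :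
    Shute2021_prop32 := by
  intro ε hε
  obtain ⟨C, hC, H⟩ := quadricCount_le_of_fourthMoment_le (θ := 8 / 3) h ε hε
  refine ⟨C, hC, fun X Y hX hY => ?_⟩
  have := H X Y hX hY
  norm_num at this
  exact this

/-- Conversely, Prop. 3.2 gives back the fourth-moment bound with exponent `8/3`
(`Shute2021_prop32.fourthMoment_le`), so `Shute2021_prop32` is EQUIVALENT to the fourth-moment
bound `N(X, Y) ≪_ε X^{2+ε} Y^{8/3+ε}`. [cite: Shute2021, §3, proof of Prop. 3.2] -/
theorem Shute2021_prop32_iff_fourthMoment_le :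
    Shute2021_prop32 ↔
      ∀ ε : ℝ, 0 < ε → ∃ C : ℝ, 0 < C ∧ ∀ X Y : ℕ, 1 ≤ X → 1 ≤ Y →
        (fourthMoment X Y : ℝ) ≤ C * (X : ℝ) ^ (2 + ε) * (Y : ℝ) ^ (8 / 3 + ε) :=
  ⟨fun h => h.fourthMoment_le, Shute2021_prop32_of_fourthMoment_le⟩

end Assembly

end Shute2021

end Literature.NumberTheory.DiophantineGeometry
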